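import Summits.CriticalPhenomena.SAWScalingLimit.Theorems.SAWDevelopingMapObservableToSLETypeLadderCarvedReductionSqueezeLimitData
import Summits.CriticalPhenomena.SAWScalingLimit.Theorems.SAWDevelopingMapObservableToSLETypeLadderCarvedReductionSqueezeSideStructure
import HarnessLib

/-!
# The two side structures of the bundled limit data (piece (T-A′₂F sides) of stub T-A′₂F
# `stub_carvedReduction_squeezeGeometry_domainsCoreF`)

Crux `SAWDevelopingMap.ObservableToSLE` (stmt-CriticalPhenomena-10472), line `six-class-type-ladder`,
stub T-A′₂F `stub_carvedReduction_squeezeGeometry_domainsCoreF`.  Landing target: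
`Summits/CriticalPhenomena/SAWScalingLimit/Theorems/SAWDevelopingMapObservableToSLETypeLadderCarvedReductionSqueezeSides.lean`.

`SqueezeLimit.sides`: `sideStructure` for the `S`-side and the `T`-side of a `SqueezeLimit`.
The one non-bookkeeping step: the exact window of the UNION of the two carved levels at the gate
`P₀` (a STAGE-1a fact) is an exact window for the `S`-level alone, because the `T`-level stays
`R`-close to its pinned root `→ D.pt 1 - τ`, more than `R + ρ/2` away from `P₀`
(`eventually_window_side`); symmetrically at `P₁`.
Registered carrier: `stub_carvedReduction_sides`.
-/

noncomputable section

open scoped Topology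
open Filter Set Metric
open Literature.Probability.LatticeModels (HexVertex hexGraph hexCenter triEmbed Site)
open Literature.Probability.RandomPlanarGeometry

namespace Summit.CriticalPhenomena.SAWScalingLimit.Theorems.ObservableToSLE.TypeLadder

open Summit.CriticalPhenomena.SAWScalingLimit.Theorems.ObservableToSLER.BridgeGate

/-- **The exact window of one side**: from the exact window of `A ∪ B` about `P` and the
eventual absence of `B` from the window. -/
theorem eventually_window_side {s : ℕ → ℝ} {x : ℕ → Site 2} {A B : ℕ → Set HexVertex} {q₀ : ℕ → HexVertex} {P : ℂ} {r : ℝ}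
    (hU : ∀ᶠ j in atTop, ∀ v : HexVertex, (s j : ℂ) * hexCenter v - (s j : ℂ) * triEmbed (x j) ∈ ball P r →
      (v ∈ A j ∪ B j ↔ v.1 1 < (q₀ j).1 1))
    (hB : ∀ᶠ j in atTop, ∀ v ∈ B j, (s j : ℂ) * hexCenter v - (s j : ℂ) * triEmbed (x j) ∉ ball P r) :
    ∀ᶠ j in atTop, ∀ v : HexVertex, (s j : ℂ) * hexCenter v - (s j : ℂ) * triEmbed (x j) ∈ ball P r →
      (v ∈ A j ↔ v.1 1 < (q₀ j).1 1) := by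
  filter_upwards [hU, hB] with j hj hBj v hv
  have hvB : v ∉ B j := fun h => hBj v h hv
  rw [← hj v hv]
  exact ⟨fun h => Or.inl h, fun h => h.resolve_right hvB⟩

/-- **The other side stays off the window**: a level `R`-close to pinned roots converging to `α`
with `R + r < dist P α` is eventually off `ball P r`. -/
theorem eventually_far_side {s : ℕ → ℝ} {x : ℕ → Site 2} {B : ℕ → Set HexVertex} {c : ℕ → HexVertex} {P α : ℂ} {R r : ℝ}
    (hloc : ∀ j, ∀ v ∈ B j, dist ((s j : ℂ) * hexCenter v) ((s j : ℂ) * hexCenter (c j)) ≤ R)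
    (hroot : Tendsto (fun j => (s j : ℂ) * hexCenter (c j) - (s j : ℂ) * triEmbed (x j)) atTop (𝓝 α))
    (hfar : R + r < dist P α) :
    ∀ᶠ j in atTop, ∀ v ∈ B j, (s j : ℂ) * hexCenter v - (s j : ℂ) * triEmbed (x j) ∉ ball P r := by
  have h1 : ∀ᶠ j in atTop, dist ((s j : ℂ) * hexCenter (c j) - (s j : ℂ) * triEmbed (x j)) α < dist P α - (R + r) :=
    (tendsto_iff_dist_tendsto_zero.1 hroot).eventually (gt_mem_nhds (by linarith))
  filter_upwards [h1] with j hj v hv hvball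
  have h2 : dist ((s j : ℂ) * hexCenter v - (s j : ℂ) * triEmbed (x j)) ((s j : ℂ) * hexCenter (c j) - (s j : ℂ) * triEmbed (x j)) ≤ R := by
    rw [dist_sub_right]; exact hloc j v hv
  have h3 := mem_ball.1 hvball
  linarith [dist_triangle P ((s j : ℂ) * hexCenter v - (s j : ℂ) * triEmbed (x j)) α,
    dist_triangle ((s j : ℂ) * hexCenter v - (s j : ℂ) * triEmbed (x j)) ((s j : ℂ) * hexCenter (c j) - (s j : ℂ) * triEmbed (x j)) α,
    dist_comm P ((s j : ℂ) * hexCenter v - (s j : ℂ) * triEmbed (x j))]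

/-- **THE TWO SIDE STRUCTURES OF THE LIMIT DATA** (`sideStructure` for both sides). -/
theorem SqueezeLimit.sides {D : DobrushinDomain} {a b : ℝ → HexVertex} {δ : ℕ → ℝ} {S T : ℕ → ℕ → Set HexVertex}
    {n n' : ℕ → ℕ} {q q' : ℕ → HexVertex} {κ : ℕ → ℕ} {ρ R : ℝ} {N : ℕ}
    (Λ : SqueezeLimit D a b δ S T n n' q q' κ ρ R N) :
    (IsClosed (⋃ i, {z : ℂ | ∀ ℓ : Fin 3, |skewCoord ℓ (z - Λ.CS i)| ≤ Λ.ϱS i}) ∧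
      (∀ i (z : ℂ), (∀ ℓ : Fin 3, |skewCoord ℓ (z - Λ.CS i)| ≤ Λ.ϱS i) → dist z (D.pt 0 - Λ.τ) ≤ R) ∧
      (∀ ε > (0 : ℝ), ∀ᶠ j in atTop, ∀ (i : Fin N) (z : ℂ), (∀ ℓ : Fin 3, |skewCoord ℓ (z - Λ.CS i)| ≤ Λ.ϱS i) →
        ∃ v ∈ S (κ j) (n (κ j)), dist (((δ (κ j) : ℝ) : ℂ) * hexCenter v - ((δ (κ j) : ℝ) : ℂ) * triEmbed (Λ.x j)) z < ε) ∧
      (∀ z : ℂ, dist z Λ.P₀ < ρ / 2 → Λ.P₀.im < z.im → z ∉ ⋃ i, {z : ℂ | ∀ ℓ : Fin 3, |skewCoord ℓ (z - Λ.CS i)| ≤ Λ.ϱS i}) ∧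
      IsConnected (⋃ i, {z : ℂ | ∀ ℓ : Fin 3, |skewCoord ℓ (z - Λ.CS i)| ≤ Λ.ϱS i}) ∧
      D.pt 0 - Λ.τ ∈ (⋃ i, {z : ℂ | ∀ ℓ : Fin 3, |skewCoord ℓ (z - Λ.CS i)| ≤ Λ.ϱS i}) ∧
      {z : ℂ | infDist z Λ.KS < ρ / 8} ⊆ (⋃ i, {z : ℂ | ∀ ℓ : Fin 3, |skewCoord ℓ (z - Λ.CS i)| ≤ Λ.ϱS i}) ∧
      {z : ℂ | infDist z Λ.BS < ρ / 4} ⊆ (⋃ i, {z : ℂ | ∀ ℓ : Fin 3, |skewCoord ℓ (z - Λ.CS i)| ≤ Λ.ϱS i}) ∧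
      {z : ℂ | z.im < Λ.P₀.im} ∩ ball Λ.P₀ (ρ / 2) ⊆ (⋃ i, {z : ℂ | ∀ ℓ : Fin 3, |skewCoord ℓ (z - Λ.CS i)| ≤ Λ.ϱS i}) ∧
      sideZone Λ.P₀ ρ Λ.KS Λ.BS (fun i => (Λ.CS i, Λ.ϱS i)) (fun i => (Λ.CcS i, Λ.ϱcS i)) 0 ⊆
        (⋃ i, {z : ℂ | ∀ ℓ : Fin 3, |skewCoord ℓ (z - Λ.CS i)| ≤ Λ.ϱS i})) ∧
    (IsClosed (⋃ i, {z : ℂ | ∀ ℓ : Fin 3, |skewCoord ℓ (z - Λ.CT i)| ≤ Λ.ϱT i}) ∧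
      (∀ i (z : ℂ), (∀ ℓ : Fin 3, |skewCoord ℓ (z - Λ.CT i)| ≤ Λ.ϱT i) → dist z (D.pt 1 - Λ.τ) ≤ R) ∧
      (∀ ε > (0 : ℝ), ∀ᶠ j in atTop, ∀ (i : Fin N) (z : ℂ), (∀ ℓ : Fin 3, |skewCoord ℓ (z - Λ.CT i)| ≤ Λ.ϱT i) →
        ∃ v ∈ T (κ j) (n' (κ j)), dist (((δ (κ j) : ℝ) : ℂ) * hexCenter v - ((δ (κ j) : ℝ) : ℂ) * triEmbed (Λ.x j)) z < ε) ∧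
      (∀ z : ℂ, dist z Λ.P₁ < ρ / 2 → Λ.P₁.im < z.im → z ∉ ⋃ i, {z : ℂ | ∀ ℓ : Fin 3, |skewCoord ℓ (z - Λ.CT i)| ≤ Λ.ϱT i}) ∧
      IsConnected (⋃ i, {z : ℂ | ∀ ℓ : Fin 3, |skewCoord ℓ (z - Λ.CT i)| ≤ Λ.ϱT i}) ∧
      D.pt 1 - Λ.τ ∈ (⋃ i, {z : ℂ | ∀ ℓ : Fin 3, |skewCoord ℓ (z - Λ.CT i)| ≤ Λ.ϱT i}) ∧
      {z : ℂ | infDist z Λ.KT < ρ / 8} ⊆ (⋃ i, {z : ℂ | ∀ ℓ : Fin 3, |skewCoord ℓ (z - Λ.CT i)| ≤ Λ.ϱT i}) ∧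
      {z : ℂ | infDist z Λ.BT < ρ / 4} ⊆ (⋃ i, {z : ℂ | ∀ ℓ : Fin 3, |skewCoord ℓ (z - Λ.CT i)| ≤ Λ.ϱT i}) ∧
      {z : ℂ | z.im < Λ.P₁.im} ∩ ball Λ.P₁ (ρ / 2) ⊆ (⋃ i, {z : ℂ | ∀ ℓ : Fin 3, |skewCoord ℓ (z - Λ.CT i)| ≤ Λ.ϱT i}) ∧
      sideZone Λ.P₁ ρ Λ.KT Λ.BT (fun i => (Λ.CT i, Λ.ϱT i)) (fun i => (Λ.CcT i, Λ.ϱcT i)) 0 ⊆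
        (⋃ i, {z : ℂ | ∀ ℓ : Fin 3, |skewCoord ℓ (z - Λ.CT i)| ≤ Λ.ϱT i})) := by
  have hs : ∀ j, 0 < δ (κ j) := Λ.spos
  have hs0 : Tendsto (fun j => δ (κ j)) atTop (𝓝 0) := Λ.s0.mono_right nhdsWithin_le_nhds
  -- the gates are far from the other roots
  have hd : dist (D.pt 0 - Λ.τ) (D.pt 1 - Λ.τ) = dist (D.pt 0) (D.pt 1) := dist_sub_right _ _ _
  have hP0 : dist Λ.P₀ (D.pt 0 - Λ.τ) ≤ R := by simpa using Λ.hPα 0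
  have hP1 : dist Λ.P₁ (D.pt 1 - Λ.τ) ≤ R := by simpa using Λ.hPα 1
  have hfar0 : R + ρ / 2 < dist Λ.P₀ (D.pt 1 - Λ.τ) := by
    linarith [dist_triangle (D.pt 0 - Λ.τ) Λ.P₀ (D.pt 1 - Λ.τ), dist_comm (D.pt 0 - Λ.τ) Λ.P₀, Λ.hsep, Λ.hρ, hd]
  have hfar1 : R + ρ / 2 < dist Λ.P₁ (D.pt 0 - Λ.τ) := by
    linarith [dist_triangle (D.pt 0 - Λ.τ) Λ.P₁ (D.pt 1 - Λ.τ), dist_comm (D.pt 0 - Λ.τ) Λ.P₁, Λ.hsep, Λ.hρ, hd]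
  -- exact windows for one side
  have hwinS := eventually_window_side Λ.hU (eventually_far_side (s := fun j => δ (κ j)) Λ.hTloc Λ.hroot1 hfar0)
  have hwinT : ∀ᶠ j in atTop, ∀ v : HexVertex,
      ((δ (κ j) : ℝ) : ℂ) * hexCenter v - ((δ (κ j) : ℝ) : ℂ) * triEmbed (Λ.x j) ∈ ball Λ.P₁ (ρ / 2) →
        (v ∈ T (κ j) (n' (κ j)) ↔ v.1 1 < (q' (κ j)).1 1) := by
    have h1 : ∀ᶠ j in atTop, ∀ v : HexVertex,
        ((δ (κ j) : ℝ) : ℂ) * hexCenter v - ((δ (κ j) : ℝ) : ℂ) * triEmbed (Λ.x j) ∈ ball Λ.P₁ (ρ / 2) →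
          (v ∈ T (κ j) (n' (κ j)) ∪ S (κ j) (n (κ j)) ↔ v.1 1 < (q' (κ j)).1 1) := by
      filter_upwards [Λ.hU'] with j hj v hv; rw [union_comm]; exact hj v hv
    exact eventually_window_side h1 (eventually_far_side (s := fun j => δ (κ j)) Λ.hSloc Λ.hroot0 hfar1)
  refine ⟨?_, ?_⟩
  · exact sideStructure (s := fun j => δ (κ j)) hs hs0 Λ.hϱS0 Λ.hLS Λ.hCS Λ.hradS Λ.hpersS Λ.hconv hwinS Λ.hKperS Λ.hBperS
      Λ.hconnS Λ.hSroot Λ.hroot0 Λ.hSpre Λ.hSloc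
  · exact sideStructure (s := fun j => δ (κ j)) hs hs0 Λ.hϱT0 Λ.hLT Λ.hCT Λ.hradT Λ.hpersT Λ.hconv' hwinT Λ.hKperT Λ.hBperT
      Λ.hconnT Λ.hTroot Λ.hroot1 Λ.hTpre Λ.hTloc

/-- **Registered carrier `stub_carvedReduction_sides`** (crux item stmt-CriticalPhenomena-10472, stub
T-A′₂F `stub_carvedReduction_squeezeGeometry_domainsCoreF`, piece THE SIDES): the exact window of one
side from the exact window of the union. -/
theorem stub_carvedReduction_sides :
    ∀ (s : ℕ → ℝ) (x : ℕ → Site 2) (A B : ℕ → Set HexVertex) (q₀ : ℕ → HexVertex) (P : ℂ) (r : ℝ),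
      (∀ᶠ j in atTop, ∀ v : HexVertex, (s j : ℂ) * hexCenter v - (s j : ℂ) * triEmbed (x j) ∈ ball P r →
        (v ∈ A j ∪ B j ↔ v.1 1 < (q₀ j).1 1)) →
      (∀ᶠ j in atTop, ∀ v ∈ B j, (s j : ℂ) * hexCenter v - (s j : ℂ) * triEmbed (x j) ∉ ball P r) →
      ∀ᶠ j in atTop, ∀ v : HexVertex, (s j : ℂ) * hexCenter v - (s j : ℂ) * triEmbed (x j) ∈ ball P r →
        (v ∈ A j ↔ v.1 1 < (q₀ j).1 1) :=
  fun _ _ _ _ _ _ _ hU hB => eventually_window_side hU hB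

end Summit.CriticalPhenomena.SAWScalingLimit.Theorems.ObservableToSLE.TypeLadder

end
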